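import Literature.NumberTheory.Automorphic.AutomorphicRepsGLOneArchParameter
import Mathlib.Analysis.SpecialFunctions.ExpDeriv
import HarnessLib

/-!
# The archimedean parameter of an automorphic representation of `GL₁(𝔸_K)` determines and is
# determined by the infinitesimal character, clause by clause

Topic `NumberTheory/Automorphic`; proof file (theorems only: no definition, no named fact, no
instance), companion of `AutomorphicRepsGLOneArchParameter` for the rank-one case of the named fact
`ArthurClozel1989_strongLifting_archimedean` (`BaseChangeArchimedean`; Arthur–Clozel (1989), Ch. 3,
Thm. 5.1 with Ch. 1 §7).

* `AutomorphicRepData.archParameter_clauses_glOne` — converse of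
  `AutomorphicRepData.hasArchParameter_glOne_of_eq_smul_one`: if `𝔤𝔩₁(K_∞)` acts on `W / W'`
  through the real linear form `d` and `χ` is an archimedean parameter of `π`, then
  `χ(σ_w) = {d(1_w)}` at every real place and `χ(τ ∘ σ_w) = {proj (a ↦ d(a_w)) τ 1}` at every
  complex place (uniqueness of Harish-Chandra parameters, `HasHCParameter.unique`).
* `AutomorphicRepData.lieDeriv_sub_smul_mem_of_hasLieAction_glOne` — the scalar `d(X)` of the Lie
  action is the scalar of the Lie derivative modulo `W'`: `X φ - d(X) φ ∈ W'`.
* `eq_of_forall_cexp_mul_eq` — `t ↦ e^{tμ}` determines `μ` (derivative at `0`).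

## References

* L. Clozel, *Motifs et formes automorphes* (1990), §3.3 [Clozel1990].
* A. W. Knapp, *Lie Groups Beyond an Introduction* (2002), Thm. 5.44 [Knapp2002].
* J. Arthur, L. Clozel, Ann. of Math. Stud. 120 (1989), Ch. 1 §7, Ch. 3 Thm. 5.1 [ArthurClozelAMS120].
-/

-- Mathlib idiom (Mathlib/Algebra/Lie/OfAssociative.lean); needed to mention Lie algebra
-- representations `𝔤 →ₗ⁅ℝ⁆ End V` on matrix algebras and endomorphism rings
attribute [local instance 100] LieRing.ofAssociativeRing

noncomputable section

open scoped Matrix Classical ComplexConjugate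
open NumberField NumberField.InfinitePlace NumberField.mixedEmbedding

namespace Literature.NumberTheory.Automorphic

/-- **`t ↦ e^{tμ}` determines `μ`**: if `e^{tμ} = e^{tν}` for all real `t` then `μ = ν` (compare
derivatives at `t = 0`). [folklore] -/
theorem eq_of_forall_cexp_mul_eq {μ ν : ℂ} (h : ∀ t : ℝ, Complex.exp (t * μ) = Complex.exp (t * ν)) :
    μ = ν := by
  have hd : ∀ c : ℂ, HasDerivAt (fun t : ℝ => Complex.exp (t * c)) c 0 := by
    intro c
    have h1 : HasDerivAt (fun t : ℝ => (t : ℂ) * c) c 0 := by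
      have := ((hasDerivAt_id (0 : ℝ)).ofReal_comp).mul_const c
      simpa using this
    have h2 := h1.cexp
    simp only [Complex.ofReal_zero, zero_mul, Complex.exp_zero, one_mul] at h2
    exact h2
  have hfun : (fun t : ℝ => Complex.exp (t * μ)) = fun t : ℝ => Complex.exp (t * ν) := funext h
  have := (hd μ).unique (hfun ▸ hd ν)
  exact this

section GLOne

variable {K : Type} [Field K] [NumberField K] {hcpt : isCompact_glFiniteIntegralLevel 1 K}

/-- **The scalar of the Lie action is the scalar of the Lie derivative modulo `W'`**: if `ρ𝔤` is
the Lie algebra action of `π` on `W / W'` and `ρ𝔤 X = d(X) · 1`, then `X φ - d(X) φ ∈ W'` for all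
`φ ∈ W`. Borel–Jacquet 1979, 4.6. [folklore] -/
theorem AutomorphicRepData.lieDeriv_sub_smul_mem_of_hasLieAction_glOne
    (π : AutomorphicRepData (AutomorphyDatum.gl 1 K hcpt))
    {ρ𝔤 : (AutomorphyDatum.gl 1 K hcpt).arch.lie →ₗ⁅ℝ⁆ Module.End ℂ π.Quot} (hρ : π.HasLieAction ρ𝔤)
    {d : (AutomorphyDatum.gl 1 K hcpt).arch.lie →ₗ[ℝ] ℂ}
    (hd : ∀ X, ρ𝔤 X = d X • (1 : Module.End ℂ π.Quot)) (X : (AutomorphyDatum.gl 1 K hcpt).arch.lie)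
    {φ : (AdelicGroupData.gl 1 K).Adelic → ℂ} (hφ : φ ∈ π.W) :
    lieDeriv (AutomorphyDatum.gl 1 K hcpt).ofArch X φ - d X • φ ∈ π.W' := by
  have h := hρ X ⟨φ, hφ⟩
  rw [hd, LinearMap.smul_apply, Module.End.one_apply, ← map_smul, eq_comm, ← sub_eq_zero,
    ← map_sub, Submodule.mkQ_apply, Submodule.Quotient.mk_eq_zero] at h
  simp only [AutomorphicRepData.kerQuot, AutomorphicRepData.lieDerivW, Submodule.mem_comap,
    Submodule.subtype_apply] at h
  exact h

/-- **The clauses of the archimedean parameter of `π`** (converse of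
`hasArchParameter_glOne_of_eq_smul_one`): if `𝔤𝔩₁(K_∞)` acts on `W / W'` through the real linear
form `d` and `χ` is an archimedean parameter of `π`, then `χ(σ_w) = {d(1_w)}` at every real place
`w` and `χ(τ ∘ σ_w) = {proj (a ↦ d(a_w)) τ 1}` at every complex place `w` and `τ ∈ {id, conj}`
(the Lie action is unique, `hasLieAction_unique`, and Harish-Chandra parameters are unique,
`HasHCParameter.unique`). Clozel (1990), §3.3; Knapp (2002), Thm. 5.44. [cite: Clozel1990, §3.3] -/
theorem AutomorphicRepData.archParameter_clauses_glOne
    (π : AutomorphicRepData (AutomorphyDatum.gl 1 K hcpt))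
    {ρ𝔤 : (AutomorphyDatum.gl 1 K hcpt).arch.lie →ₗ⁅ℝ⁆ Module.End ℂ π.Quot} (hρ : π.HasLieAction ρ𝔤)
    (d : (AutomorphyDatum.gl 1 K hcpt).arch.lie →ₗ[ℝ] ℂ)
    (hd : ∀ X, ρ𝔤 X = d X • (1 : Module.End ℂ π.Quot))
    {χ : (K →+* ℂ) → Multiset ℂ} (hχ : π.HasArchParameter χ) :
    (∀ w : {w : InfinitePlace K // w.IsReal}, χ w.1.embedding = {d ⟨realPlaceLie 1 w 1, trivial⟩}) ∧
      ∀ (w : {w : InfinitePlace K // w.IsComplex}) (τ : ℂ →ₐ[ℝ] ℂ),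
        χ (τ.toRingHom.comp w.1.embedding) =
          {HCEmb.proj (fun a : ℂ => d ⟨complexPlaceLie 1 w (a • (1 : Matrix (Fin 1) (Fin 1) ℂ)), trivial⟩)
            τ 1} := by
  haveI : Nontrivial π.Quot := π.nontrivial_quot
  obtain ⟨ρ', hρ', hre, hco⟩ := hχ
  obtain rfl : ρ𝔤 = ρ' := π.hasLieAction_unique hρ hρ'
  refine ⟨fun w => ?_, fun w τ => ?_⟩
  · -- real place `w`
    let L : ℝ →ₗ[ℝ] ℂ := d ∘ₗ
      ((LieSubalgebra.topEquiv.symm : Matrix (Fin 1) (Fin 1) (mixedSpace K) ≃ₗ⁅ℝ⁆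
          (⊤ : LieSubalgebra ℝ (Matrix (Fin 1) (Fin 1) (mixedSpace K)))).toLinearMap ∘ₗ
        (realPlaceLie 1 w).toLinearMap ∘ₗ
          (LinearMap.toSpanSingleton ℝ (Matrix (Fin 1) (Fin 1) ℝ) 1))
    have hL : ∀ a : ℝ, L a = d ⟨realPlaceLie 1 w (a • (1 : Matrix (Fin 1) (Fin 1) ℝ)), trivial⟩ :=
      fun a => rfl
    have h := hasHCParameter_glOne_of_eq_smul_one
      ((ρ𝔤.comp (LieSubalgebra.topEquiv :
        (⊤ : LieSubalgebra ℝ (Matrix (Fin 1) (Fin 1) (mixedSpace K))) ≃ₗ⁅ℝ⁆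
          Matrix (Fin 1) (Fin 1) (mixedSpace K)).symm.toLieHom).comp (realPlaceLie 1 w)) L
      (fun a => by rw [hL]; exact hd _)
    have e := congr_fun (HasHCParameter.unique _ (hre w) h) (Algebra.ofId ℝ ℂ)
    rw [e]
    congr 1
    rw [HCEmb.proj_def, HCEmb.card_algHom_of_I_eq_zero RCLike.I_to_real, RCLike.I_to_real]
    simp only [zero_smul, map_zero, smul_zero, add_zero, Nat.cast_one, inv_one, one_smul]
    rw [hL, one_smul]
  · -- complex place `w`
    let L : ℂ →ₗ[ℝ] ℂ := d ∘ₗ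
      ((LieSubalgebra.topEquiv.symm : Matrix (Fin 1) (Fin 1) (mixedSpace K) ≃ₗ⁅ℝ⁆
          (⊤ : LieSubalgebra ℝ (Matrix (Fin 1) (Fin 1) (mixedSpace K)))).toLinearMap ∘ₗ
        (complexPlaceLie 1 w).toLinearMap ∘ₗ
          ((LinearMap.toSpanSingleton ℂ (Matrix (Fin 1) (Fin 1) ℂ) 1).restrictScalars ℝ))
    have hL : ∀ a : ℂ, L a = d ⟨complexPlaceLie 1 w (a • (1 : Matrix (Fin 1) (Fin 1) ℂ)), trivial⟩ :=
      fun a => rfl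
    have h := hasHCParameter_glOne_of_eq_smul_one
      ((ρ𝔤.comp (LieSubalgebra.topEquiv :
        (⊤ : LieSubalgebra ℝ (Matrix (Fin 1) (Fin 1) (mixedSpace K))) ≃ₗ⁅ℝ⁆
          Matrix (Fin 1) (Fin 1) (mixedSpace K)).symm.toLieHom).comp (complexPlaceLie 1 w)) L
      (fun a => by rw [hL]; exact hd _)
    have e := congr_fun (HasHCParameter.unique _ (hco w) h) τ
    exact e

end GLOne

end Literature.NumberTheory.Automorphic
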